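import Summits.HodgeConjecture.HodgeConjecture.Theses.BoundaryReadout
import Literature.AlgebraicGeometry.HodgeTheory.AbsoluteHodgeClasses
import Literature.AlgebraicGeometry.HodgeTheory.HodgeTypeExteriorProduct

/-!
# Birth skeleton (BC3) of the crux `BoundaryAbsoluteness` (stmt-HodgeConjecture-15913),
# route `BoundaryReadout` — line `birth`: σ-naturality package + LMHS-free boundary readout

`BoundaryAbsoluteness` (rank 3 of `BoundaryReadout`; decl
`Summit.HodgeConjecture.HodgeConjecture.Theses.BoundaryReadout.BoundaryAbsoluteness`): for
`f : 𝒳 ⟶ C` (𝒳 smooth projective of dimension `N`, `C` a smooth projective curve, `f` surjective),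
`o ∈ C(ℂ)`, finitely many smooth projective `g_i : Y_i ⟶ X_o` JOINTLY COVERING the fibre, and a
rational `(p,p)` class `ξ ∈ H²ᵖ(𝒳(ℂ); ℂ)` whose restrictions `ξ|Y_i` are all absolute Hodge:
`ξ|X_t` is absolute Hodge on every smooth projective fibre `X_t`.

Unfolding `IsAbsoluteHodgeClass n X_t p (ξ|X_t)` (Charles–Schnell Def. 11.2.3 on the tree's
carriers): (i) `ξ|X_t` rational — `IsRationalClass.pullback`, PROVED; (ii) of type `(p,p)` —
`IsOfHodgeType.map_of_isSmoothProjective`, PROVED; (iii) for every `σ ∈ Aut ℂ` a `σ`-conjugate of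
`ξ|X_t` EXISTS — STUB 1; (iv) every `σ`-conjugate `c'` of `ξ|X_t` is `(2πi/σ(2πi))ᵖ · β` with
`β` rational of type `(p,p)` on `X_t^σ` — the heart, cut as follows. Let `Ξ'` be a conjugate of `ξ`
on `𝒳^σ` (STUB 1 on `𝒳`). NATURALITY of conjugation (STUB 2: conjugation commutes with pull-backs
and is single-valued) gives `c' = (ι_t^σ)^* Ξ'` and `(g_i ≫ ι_o)^{σ*} Ξ' =` THE conjugate of
`ξ|Y_i`, which by the absoluteness hypothesis is `(2πi/σ(2πi))ᵖ · β_i`, `β_i` rational. So the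
class `Θ := (2πi/σ(2πi))^{-p} · Ξ' ∈ H²ᵖ(𝒳^σ(ℂ); ℂ)` has RATIONAL restrictions to all the
conjugate pieces `Y_i^σ`, which jointly cover the conjugate fibre `X_o^σ`. The BOUNDARY READOUT
(STUB 4) is the purely topological/Hodge-III statement that such a class — ANY complex class on
the conjugate total space with rational restrictions to the covering pieces of one fibre — has
rational restriction to `X_t^σ` for every smooth projective fibre: by Deligne, Hodge III
Prop. 8.2.7 (tree: PROVED fact `Deligne1974_ker_pullback_eq_ker_pullback_resolution_holds`)
`ker(H(𝒳^σ) → ⊕ H(Y_i^σ)) = ker(H(𝒳^σ) → H(tube of X_o^σ))`, both maps are defined over `ℚ`, so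
`Θ` agrees near `X_o^σ` with a RATIONAL global class `θ₀`; the tube lemma (properness of `f^σ`)
carries this to the smooth fibres near `o^σ`, and Ehresmann/flatness of `R f^σ_* ℚ` over the
connected smooth locus of the conjugate curve `C^σ` carries `Θ|_s = θ₀|_s` to every smooth fibre,
in particular to `(𝒳^σ)_{t^σ} ≅ X_t^σ`. No limit mixed Hodge structure, `sp` or Clemens–Schmid is
needed (the route header's proof sketch through `H_lim` is replaced by the kernel identity; this is
the lever recorded on the item by the idea-node card `boundary-kernel-factorisation`, 2026-08-16).
Then `β := (ι_t^σ)^* Θ` is rational, `c' = (2πi/σ(2πi))ᵖ · β`, and `β` is of type `(p,p)` by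
STUB 3 (conjugation preserves the algebraic Hodge filtration `Fᵖ`; a rational class of `Fᵖ H²ᵖ` is
of type `(p,p)` — Charles–Schnell (11.2.3), Voisin 2007 Rem. 2.2).

## Contents

* `stub_conjugate_exists` (STUB 1, infrastructure theorem in print: Jouanolou + GAGA + de Rham +
  Grothendieck comparison; VERBATIM the stub of the same name of
  `Cruxes/HCOverNumberFields/Lines/birth.lean`, one obligation for both lines);
* `stub_conjugateNaturality` (STUB 2, theorem in print: functoriality and single-valuedness of
  `α ↦ α^σ`, Charles–Schnell §11.2.2 — the Grothendieck-comparison fragment the interface's junk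
  analysis rests on);
* `stub_conjugateHodgeType` (STUB 3, theorem in print: `σ` preserves `Fᵖ`);
* `stub_boundaryReadout` (STUB 4, the heart of the line, theorem-candidate: Hodge III 8.2.7 +
  tube lemma + Ehresmann on the conjugate family; no conjugation chart occurs in it, so it is
  attackable TODAY);
* the four statements as named Props `ConjugateExists`, `ConjugateNaturality`,
  `ConjugateHodgeType`, `BoundaryRationalityReadout` (asserted VERBATIM by the stubs; the definitional
  agreement is checked by `BoundaryAbsoluteness_of_stubs`), and their name-keyed aliases `__Registered.stub_*` (skeleton-audit device);
* `BoundaryAbsoluteness_of` — the composition STUB 1 → STUB 2 → STUB 3 → STUB 4 → the crux BY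
  NAME (hypotheses = the four aliases), kernel-checked, no `sorry`, axioms
  `[propext, Classical.choice, Quot.sound]`; `BoundaryAbsoluteness_of_stubs` — the crux modulo
  exactly the four registered stubs. `sorry` occurs ONLY in the four `stub_*` theorems.

Disproof used: none on file (`ledger crux ls stmt-HodgeConjecture-15913`: no workfiles, no
`Disproof.lean` at registration; `ledger negatives --problem HodgeConjecture`: no statement about
absolute Hodge classes or degenerations). Landed Negative lemmas CHECKED AGAINST:
`Theorems/BallQuotientHodgeAbsolute/Negative/HodgeImpliesAbsoluteHodge`
(`nonempty_conjugationChart_of_isAbsoluteHodgeClass`: any proof of an absoluteness statement must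
BUILD charts for the variety in the conclusion — the hypotheses of the crux give charts on the
`Y_i` only, so this obligation is real and is STUB 1, named, not hidden) and
`…/Negative/ChartConjugationUniqueness` (`conjugates_unique_of_forall_rational`: the crux's
conclusion certifies single-valued chart conjugation on `ξ|X_t` — that fragment is STUB 2, named).
No stub is an instance those lemmas refute (they refute nothing; they locate obligations).
-/

noncomputable section

namespace Summit.HodgeConjecture.HodgeConjecture.Cruxes.BoundaryAbsoluteness.Birth

open CategoryTheory AlgebraicGeometry
open Literature.AlgebraicGeometry.Motives Literature.AlgebraicGeometry.HodgeTheory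
open Summit.HodgeConjecture.HodgeConjecture.Theses.BoundaryReadout (BoundaryAbsoluteness)

/-! ### The four statements of the line (named; the stubs below assert them verbatim) -/

/-- STATEMENT 1 — **conjugates exist** on smooth projective complex varieties: for every
`σ ∈ Aut ℂ`, degree `k` and class `c ∈ Hᵏ(X(ℂ); ℂ)` some `c' ∈ Hᵏ(X^σ(ℂ); ℂ)` is conjugate to `c` in a
conjugation chart (Jouanolou torsor + GAGA + de Rham + Grothendieck's comparison on the affine
chart). Theorem in print, absent from the tree. [cite: Jouanolou1973, Lemme 1.5]
[cite: Grothendieck1966, Thm. 1'] [cite: CharlesSchnell2014Notes, §11.2.2 (11.2.2)–(11.2.3)] -/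
def ConjugateExists : Prop :=
  ∀ ⦃n : ℕ⦄ ⦃X : SchemeOver ℂ⦄, IsSmoothProjective n X →
    ∀ (σ : ℂ ≃+* ℂ) (k : ℕ) (c : complexBetti X k), ∃ c', IsConjugateClass σ X k c c'

/-- STATEMENT 2 — **conjugation is natural** (commutes with pull-backs along morphisms of smooth
projective varieties and is single-valued): any conjugate `d'` of `g^* c` equals `(g^σ)^*` of any
conjugate `c'` of `c`. Theorem in print (functoriality of `α ↦ α^σ` on algebraic de Rham
cohomology + the comparison theorem), absent from the tree.
[cite: CharlesSchnell2014Notes, §11.2.2 (11.2.2)–(11.2.3)] [cite: Grothendieck1966, Thm. 1'] -/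
def ConjugateNaturality : Prop :=
  ∀ ⦃m n : ℕ⦄ ⦃Y X : SchemeOver ℂ⦄, IsSmoothProjective m Y → IsSmoothProjective n X →
    ∀ (g : Y ⟶ X) (σ : ℂ ≃+* ℂ) (k : ℕ) (c : complexBetti X k)
      (c' : complexBetti (conjugateVariety σ X) k) (d' : complexBetti (conjugateVariety σ Y) k),
      IsConjugateClass σ X k c c' → IsConjugateClass σ Y k (complexBetti.map g k c) d' →
        d' = complexBetti.map (conjHom σ g) k c'

/-- STATEMENT 3 — **conjugation preserves `Fᵖ`**: a conjugate `c'` of a class of type `(p,p)` which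
is `(2πi/σ(2πi))ᵖ ·` (a RATIONAL class `β`) has `β` of type `(p,p)` (Charles–Schnell (11.2.3): `σ`
respects the Hodge filtration; a rational class in `Fᵖ H²ᵖ` is of type `(p,p)`). Theorem in print,
absent from the tree. [cite: CharlesSchnell2014Notes, §11.2.2 (11.2.3) and Def. 11.2.3]
[cite: Voisin2007HodgeLoci, Rem. 2.2] -/
def ConjugateHodgeType : Prop :=
  ∀ ⦃n : ℕ⦄ ⦃X : SchemeOver ℂ⦄, IsSmoothProjective n X →
    ∀ (σ : ℂ ≃+* ℂ) (p : ℕ) (c : complexBetti X (2 * p))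
      (c' β : complexBetti (conjugateVariety σ X) (2 * p)),
      IsOfHodgeType n X (2 * p) p p c → IsConjugateClass σ X (2 * p) c c' →
        IsRationalClass β → c' = periodTwist σ p • β →
          IsOfHodgeType n (conjugateVariety σ X) (2 * p) p p β

/-- STATEMENT 4 — **boundary readout of rationality on the conjugate family** (the heart): for
the data of the crux and ANY class `Θ` on `𝒳^σ` whose restrictions to the conjugate covering pieces
`Y_i^σ` are rational, the restriction of `Θ` to `X_t^σ` is rational for every smooth projective fibre
`X_t` (Hodge III Prop. 8.2.7 = tree fact `Deligne1974_ker_pullback_eq_ker_pullback_resolution_holds`,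
PROVED; tube lemma; Ehresmann over the connected smooth locus of `C^σ`). Theorem-candidate.
[cite: DeligneHodgeIII1974, Prop. 8.2.7 and Cor. 8.2.8] [cite: Deligne1982HodgeCycles, §2 Thm. 2.12] -/
def BoundaryRationalityReadout : Prop :=
  ∀ ⦃N : ℕ⦄ ⦃𝒳 C : SchemeOver ℂ⦄ (f : 𝒳 ⟶ C) (o : AlgPoints C ℂ),
    IsSmoothProjective N 𝒳 → IsSmoothProjective 1 C → Function.Surjective f.left.base →
    ∀ ⦃ι : Type⦄ [Finite ι] ⦃m : ι → ℕ⦄ ⦃Y : ι → SchemeOver ℂ⦄ (g : ∀ i, Y i ⟶ fiberOver f o),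
      (∀ i, IsSmoothProjective (m i) (Y i)) →
      (∀ x : ↥(fiberOver f o).left, ∃ (i : ι) (y : ↥(Y i).left), (g i).left.base y = x) →
      ∀ (σ : ℂ ≃+* ℂ) (k : ℕ) (Θ : complexBetti (conjugateVariety σ 𝒳) k),
        (∀ i, IsRationalClass (complexBetti.map (conjHom σ (g i ≫ fiberι f o)) k Θ)) →
        ∀ (t : AlgPoints C ℂ) ⦃n : ℕ⦄, IsSmoothProjective n (fiberOver f t) →
          IsRationalClass (complexBetti.map (conjHom σ (fiberι f t)) k Θ)

/-! ### The four registered stubs (`sorry` only here) -/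

/-- STUB 1 (INFRASTRUCTURE — a theorem in print; L-sized in the tree) — **conjugates exist.** For
`X` smooth projective over `ℂ`, every `σ ∈ Aut ℂ`, every degree `k` and every class
`c ∈ Hᵏ(X(ℂ); ℂ)` there is a class `c' ∈ Hᵏ(X^σ(ℂ); ℂ)` conjugate to `c` in some conjugation chart
(`IsConjugateClass`): Jouanolou's affine vector-bundle torsor `π : Y → X` (`Y` smooth affine, `π^*`
and `(π^σ)^*` bijective on cohomology), analytifications of `Y` and `Y^σ` on one model space
(GAGA), the integration de Rham family (natural, rationally normalised), a closed algebraic form `ξ`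
representing `π^* c` (Grothendieck: algebraic de Rham cohomology of the smooth affine `Y` computes
`H•(Y^an; ℂ)`), and `c'` the preimage under `(π^σ)^*` of the class of `ξ^σ`. VERBATIM the stub
`stub_conjugate_exists` of `Cruxes/HCOverNumberFields/Lines/birth.lean` (one obligation, two lines).
Used here on `X_t` (conjunct (iii)) and on `𝒳` (to name `Ξ'`). Why it might fail: only through the
tree's carriers (`mextDeriv`/`wedge` must make realisations of closed algebraic forms closed; the
named fact `exists_complexDeRhamIsoFamily` must be upgraded to a NATURAL rationally normalised
family). Leans on: `ConjugationChart`, `IsConjugateClass`; `IsAnalytification`,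
`exists_isAnalytification`, `exists_complexDeRhamIsoFamily`. Size: L.
[cite: Jouanolou1973, Lemme 1.5] [cite: Grothendieck1966, Thm. 1']
[cite: CharlesSchnell2014Notes, §11.2.2 (11.2.2)–(11.2.3)] [cite: SerreGAGA1956, §2] -/
theorem stub_conjugate_exists :
    ∀ ⦃n : ℕ⦄ ⦃X : SchemeOver ℂ⦄, IsSmoothProjective n X →
      ∀ (σ : ℂ ≃+* ℂ) (k : ℕ) (c : complexBetti X k), ∃ c', IsConjugateClass σ X k c c' := by
  sorry

/-- STUB 2 (INFRASTRUCTURE — a theorem in print; M/L-sized in the tree) — **conjugation is natural: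
it commutes with pull-backs and is single-valued.** For a `ℂ`-morphism `g : Y ⟶ X` of smooth
projective varieties, `σ ∈ Aut ℂ`, a class `c ∈ Hᵏ(X(ℂ); ℂ)`, ANY conjugate `c'` of `c` on `X^σ` and
ANY conjugate `d'` of `g^* c` on `Y^σ` (each in its own conjugation chart): `d' = (g^σ)^* c'`
(`conjHom σ g = g^σ : Y^σ ⟶ X^σ`). With `g = 𝟙` this is single-valuedness of chart conjugation
(Charles–Schnell §11.2.2: all charts compute the canonical `α ↦ α^σ` of algebraic de Rham
cohomology, transported to singular cohomology — the Grothendieck-comparison fragment recorded by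
`Negative/ChartConjugationUniqueness`); in general it is functoriality of `α ↦ α^σ`
(`θ_σ ∘ g^* = (g^σ)^* ∘ θ_σ`, their (11.2.2)). Proof in print: both `(π^σ)^* c'` and
`(π'^σ)^* d'` are de Rham conjugates of pull-backs of the ONE algebraic de Rham class of `c` on the
smooth `X` (comparison theorem for `X`, `Y`, and the affine charts), and `(π^σ)^*`, `(π'^σ)^*` are
injective. Used here twice: `c' = (ι_t^σ)^* Ξ'` and `(conjugate of ξ|Y_i) = ((g_i ≫ ι_o)^σ)^* Ξ'`.
Why it might fail: a chart whose de Rham family were only `ℚˣ`-normalised up to a degree-dependent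
constant, or whose analytic models disagreed with the canonical analytification, would produce a
second value — excluded by `IsAnalytification.unique` and `IsRationalDeRhamFamily` per the module
docstring of `AbsoluteHodgeClasses` (junk analysis (1)–(2)), which is exactly what the proof must
make formal. Leans on: `ConjugationChart.Conjugates`, `conjHom`, `complexBetti.map`,
`baseChangeHom`; `Negative/ChartConjugationUniqueness.conjugates_smul/_add` (chart calculus).
Size: L. [cite: CharlesSchnell2014Notes, §11.2.2 (11.2.2)–(11.2.3)] [cite: Grothendieck1966, Thm. 1'] -/
theorem stub_conjugateNaturality :
    ∀ ⦃m n : ℕ⦄ ⦃Y X : SchemeOver ℂ⦄, IsSmoothProjective m Y → IsSmoothProjective n X →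
      ∀ (g : Y ⟶ X) (σ : ℂ ≃+* ℂ) (k : ℕ) (c : complexBetti X k)
        (c' : complexBetti (conjugateVariety σ X) k) (d' : complexBetti (conjugateVariety σ Y) k),
        IsConjugateClass σ X k c c' → IsConjugateClass σ Y k (complexBetti.map g k c) d' →
          d' = complexBetti.map (conjHom σ g) k c' := by
  sorry

/-- STUB 3 (INFRASTRUCTURE — a theorem in print; M/L-sized in the tree) — **conjugation preserves
`Fᵖ`: a twisted-rational conjugate of a `(p,p)` class is a twisted Hodge class.** For `X` smooth
projective of dimension `n`, `c ∈ H²ᵖ(X(ℂ); ℂ)` of Hodge type `(p,p)`, `σ ∈ Aut ℂ`, a conjugate `c'`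
of `c` on `X^σ`, and a RATIONAL `β` with `c' = (2πi/σ(2πi))ᵖ · β`: `β` is of Hodge type `(p,p)` on
`X^σ`. In print: `α ↦ α^σ` is an isomorphism of algebraic de Rham cohomology compatible with the
Hodge filtration `Fᵖ = im H(Ω^{≥p})` (Charles–Schnell (11.2.3); Voisin 2007 Rem. 2.2 "hence a Hodge
class"), so `β ∈ Fᵖ H²ᵖ(X^σ)`; a rational (hence real) class in `Fᵖ H²ᵖ` lies in
`Fᵖ ∩ \overline{Fᵖ} = H^{p,p}`. NOT claimed: that conjugation preserves the type `(p,q)` of a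
transcendental class (false — only `F` is algebraic). Why it might fail: the tree's `IsOfHodgeType`
is read in Hodge models of `X^σ` (exist: `IsSmoothProjective.conjugateVariety_holds` +
`nonempty_hodgeModel_holds`), and the chart presents `c` on an AFFINE `Y`, where `Fᵖ` of the
projective `X` is invisible — the proof needs the filtered comparison `Fᵖ H_dR(X) ≅ Fᵖ H(X^an)`
(Hodge–de Rham degeneration, GAGA), absent from the tree. Leans on: `IsOfHodgeType`, `HodgeModel`,
`IsConjugateClass`, `periodTwist`, `conjugateVariety`, `IsOfHodgeType.conjClass`
(HodgeTypeConjugation: `\overline{H^{p,q}} = H^{q,p}`, PROVED). Size: L.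
[cite: CharlesSchnell2014Notes, §11.2.2 (11.2.3) and Def. 11.2.3] [cite: Voisin2007HodgeLoci, Rem. 2.2]
[cite: Deligne1982HodgeCycles, §2 Prop. 2.9] -/
theorem stub_conjugateHodgeType :
    ∀ ⦃n : ℕ⦄ ⦃X : SchemeOver ℂ⦄, IsSmoothProjective n X →
      ∀ (σ : ℂ ≃+* ℂ) (p : ℕ) (c : complexBetti X (2 * p))
        (c' β : complexBetti (conjugateVariety σ X) (2 * p)),
        IsOfHodgeType n X (2 * p) p p c → IsConjugateClass σ X (2 * p) c c' →
          IsRationalClass β → c' = periodTwist σ p • β →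
            IsOfHodgeType n (conjugateVariety σ X) (2 * p) p p β := by
  sorry

/-- STUB 4 (THE HEART — theorem-candidate, load-bearing; attackable today, no conjugation chart in
it) — **boundary readout of rationality on the conjugate family.** Data as in the crux: `f : 𝒳 ⟶ C`
surjective, `𝒳` smooth projective of dimension `N`, `C` a smooth projective curve, `o ∈ C(ℂ)`,
finitely many smooth projective `g_i : Y_i ⟶ X_o` jointly covering the fibre; `σ ∈ Aut ℂ`; and ANY
class `Θ ∈ Hᵏ(𝒳^σ(ℂ); ℂ)` (any degree, not assumed rational or Hodge) whose restrictions along the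
conjugate pieces `(g_i ≫ ι_o)^σ : Y_i^σ ⟶ 𝒳^σ` are all RATIONAL. Then the restriction of `Θ` along
`ι_t^σ : X_t^σ ⟶ 𝒳^σ` is rational for every `t ∈ C(ℂ)` with `X_t` smooth projective. Proof plan
(three lemmas, all on the conjugate family `f^σ : 𝒳^σ ⟶ C^σ`, which is again a surjection from a
smooth projective variety onto a smooth projective curve with `(𝒳^σ)_{s^σ} ≅ (X_s)^σ` compatibly
with the inclusions, `baseChangeHom` is a pullback functor; `IsSmoothProjective.conjugateVariety_holds`):
(a) KERNEL IDENTITY near the covered fibre — Deligne, Hodge III Prop. 8.2.7, in the tree the PROVED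
`Deligne1974_ker_pullback_eq_ker_pullback_resolution_holds` applied to `X := 𝒳^σ` and the family
`(g_i ≫ ι_o)^σ` (whose images cover `X_o^σ(ℂ) = (f^σ)⁻¹(o^σ)`, surjectivity being stable under base
change): a class killed by every `Y_i^σ` vanishes on an open `V ⊇ X_o^σ(ℂ)`; both restriction maps
are defined over `ℚ` and `H•` is finite-dimensional, so `r(Θ) ∈ ⊕ H(Y_i^σ; ℚ) ∩ im r = r(H(𝒳^σ; ℚ))`
and `Θ = θ₀ + κ` with `θ₀` RATIONAL and `κ|_V = 0`; (b) TUBE LEMMA — `f^σ(ℂ)` is proper, hence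
closed, so `(f^σ)⁻¹(U) ⊆ V` for an open `U ∋ o^σ` of `C^σ(ℂ)` and `Θ|_{X_s} = θ₀|_{X_s}` is rational
for `s ∈ U`; (c) PROPAGATION — over the smooth locus `C^σ_*` (cofinite in the irreducible curve,
hence connected, and `∋` every `s` with smooth projective fibre) `R^k f^σ_* ℂ = (R^k f^σ_* ℚ) ⊗ ℂ` is a
local system (Ehresmann) of which `Θ - θ₀` is a flat section vanishing on the non-empty open
`U ∩ C^σ_*`, hence on all of `C^σ_*`; at `s = t^σ` this is the claim. Why it might fail: only in
(c) as typed — if the general fibre of `f` is disconnected (non-trivial Stein factorisation) no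
fibre is `IsSmoothProjective` (geometrically irreducible) and the statement is vacuous, fine; the
risk is a smooth projective fibre `X_t` over a point `t` OUTSIDE the smooth locus of `f` (a fibre
that is smooth but along which `f` is not smooth is impossible for flat `f`: `f` is flat, being
dominant from an integral scheme to a regular curve) — so none known; and the Ehresmann/local-system
package over `C_*(ℂ)` is not yet a tree theorem (nearest: `Motives.GeometricVHSData`, hypothesis
structure; `ContinuationAlongLiftedPaths`). Leans on: `Deligne1974_ker_pullback_eq_ker_pullback_resolution_holds`
(GysinKernelSplitHolds), `exists_isRationalClass_complexBetti_map_eq` (HodgeConjectureQbarVoisinProofs: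
rational lift through a surjection), `IsRationalClass.pullback/.add/.smul`, `fiberOver`, `fiberι`,
`conjHom`, `baseChangeHom`, `AlgPoints.map_fiberι_map_fiberOverMap` (SpecialisationMapComplexPoints),
`IsSmoothProjective.conjugateVariety_holds`. Size: L (M for (a)+(b); (c) is the Ehresmann debt).
[cite: DeligneHodgeIII1974, Prop. 8.2.7 and Cor. 8.2.8] [cite: VoisinHodgeI2002, §9.1.1 Prop. 9.3 and Thm. 9.3 (Ehresmann)]
[cite: Deligne1982HodgeCycles, §2 Thm. 2.12 (Principle B)] [cite: CharlesSchnell2014Notes, §11.2.2] -/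
theorem stub_boundaryReadout :
    ∀ ⦃N : ℕ⦄ ⦃𝒳 C : SchemeOver ℂ⦄ (f : 𝒳 ⟶ C) (o : AlgPoints C ℂ),
      IsSmoothProjective N 𝒳 → IsSmoothProjective 1 C → Function.Surjective f.left.base →
      ∀ ⦃ι : Type⦄ [Finite ι] ⦃m : ι → ℕ⦄ ⦃Y : ι → SchemeOver ℂ⦄ (g : ∀ i, Y i ⟶ fiberOver f o),
        (∀ i, IsSmoothProjective (m i) (Y i)) →
        (∀ x : ↥(fiberOver f o).left, ∃ (i : ι) (y : ↥(Y i).left), (g i).left.base y = x) →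
        ∀ (σ : ℂ ≃+* ℂ) (k : ℕ) (Θ : complexBetti (conjugateVariety σ 𝒳) k),
          (∀ i, IsRationalClass (complexBetti.map (conjHom σ (g i ≫ fiberι f o)) k Θ)) →
          ∀ (t : AlgPoints C ℂ) ⦃n : ℕ⦄, IsSmoothProjective n (fiberOver f t) →
            IsRationalClass (complexBetti.map (conjHom σ (fiberι f t)) k Θ) := by
  sorry

/-! ### Name-keyed aliases of the four statements — the hypotheses of `BoundaryAbsoluteness_of`
The native skeleton audit (`ledger skeleton check` / `#h21_check_skeleton`) admits a hypothesis of
the crux-concluding theorem only if its head constant is a registered obligation or is NAMED like a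
declared stub; `__Registered.stub_X` is the statement under the registered stub's short name (device
of `Cruxes/AlgebraicDensity/Lines/birth.lean`, `RiemannHypothesis/…/MediumKernelNoGo/Lines/pencil_bracket_count.lean`;
the audit's stub report resolves each `stub_…` to the sorried theorem above, not to its alias). -/
namespace __Registered

/-- Alias of `ConjugateExists` keyed by the registered stub name. -/
abbrev stub_conjugate_exists : Prop := ConjugateExists
/-- Alias of `ConjugateNaturality` keyed by the registered stub name. -/
abbrev stub_conjugateNaturality : Prop := ConjugateNaturality
/-- Alias of `ConjugateHodgeType` keyed by the registered stub name. -/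
abbrev stub_conjugateHodgeType : Prop := ConjugateHodgeType
/-- Alias of `BoundaryRationalityReadout` keyed by the registered stub name. -/
abbrev stub_boundaryReadout : Prop := BoundaryRationalityReadout

end __Registered

/-! ### The composition: stub₁ → stub₂ → stub₃ → stub₄ → the crux, by name -/

/-- **THE LINE'S COMPOSITION** (kernel-checked, no `sorry`). Given the four stubs, for the data of
the crux and a smooth projective fibre `X_t`: `ξ|X_t` is rational (`IsRationalClass.pullback`) and of
type `(p,p)` (`IsOfHodgeType.map_of_isSmoothProjective`, PROVED in the tree); conjugates of `ξ|X_t`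
exist (STUB 1); and for a conjugate `c'`: name a conjugate `Ξ'` of `ξ` on `𝒳^σ` (STUB 1), put
`Θ := (2πi/σ(2πi))^{-p} · Ξ'`; by STUB 2 the conjugate of `ξ|Y_i` supplied by the absoluteness
hypothesis IS `((g_i ≫ ι_o)^σ)^* Ξ' = (2πi/σ(2πi))ᵖ · β_i`, so `Θ` has rational restrictions `β_i` to
the conjugate pieces; STUB 4 makes `β := (ι_t^σ)^* Θ` rational; STUB 2 again gives
`c' = (ι_t^σ)^* Ξ' = (2πi/σ(2πi))ᵖ · β`; STUB 3 makes `β` of type `(p,p)`.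
[cite: CharlesSchnell2014Notes, Def. 11.2.3] [cite: DeligneHodgeIII1974, Prop. 8.2.7] -/
theorem BoundaryAbsoluteness_of (h₁ : __Registered.stub_conjugate_exists)
    (h₂ : __Registered.stub_conjugateNaturality) (h₃ : __Registered.stub_conjugateHodgeType)
    (h₄ : __Registered.stub_boundaryReadout) : BoundaryAbsoluteness := by
  intro N p 𝒳 C f o h𝒳 hC hf ι _ m Y g hY hcov ξ hξr hξh habs t n ht
  -- the `(p,p)` type of `ξ|X_t` (proved tree theorem: pull-backs preserve Hodge types)
  have hpp : IsOfHodgeType n (fiberOver f t) (2 * p) p p (complexBetti.map (fiberι f t) (2 * p) ξ) :=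
    hξh.map_of_isSmoothProjective ht h𝒳 (fiberι f t)
  refine ⟨hξr.pullback _, hpp, fun σ => ⟨h₁ ht σ (2 * p) _, fun c' hc' => ?_⟩⟩
  -- a conjugate `Ξ'` of the global class `ξ` on `𝒳^σ`
  obtain ⟨Ξ', hΞ'⟩ := h₁ h𝒳 σ (2 * p) ξ
  -- naturality: the given conjugate of `ξ|X_t` is the restriction of `Ξ'`
  have hc'eq : c' = complexBetti.map (conjHom σ (fiberι f t)) (2 * p) Ξ' :=
    h₂ ht h𝒳 (fiberι f t) σ (2 * p) ξ Ξ' c' hΞ' hc'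
  -- the untwisted conjugate
  obtain ⟨Θ, hΘ⟩ : ∃ Θ : complexBetti (conjugateVariety σ 𝒳) (2 * p), Θ = (periodTwist σ p)⁻¹ • Ξ' :=
    ⟨_, rfl⟩
  have htw : periodTwist σ p ≠ 0 := periodTwist_ne_zero σ p
  -- `Θ` is rational on every conjugate piece `Y_i^σ` (absoluteness of `ξ|Y_i` + naturality)
  have hΘY : ∀ i, IsRationalClass (complexBetti.map (conjHom σ (g i ≫ fiberι f o)) (2 * p) Θ) := by
    intro i
    obtain ⟨d, hd⟩ := ((habs i).2.2 σ).1
    obtain ⟨βi, hβi, -, hdβ⟩ := ((habs i).2.2 σ).2 d hd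
    have hdΞ : d = complexBetti.map (conjHom σ (g i ≫ fiberι f o)) (2 * p) Ξ' :=
      h₂ (hY i) h𝒳 (g i ≫ fiberι f o) σ (2 * p) ξ Ξ' d hΞ' hd
    rw [hΘ, map_smul, ← hdΞ, hdβ, smul_smul, inv_mul_cancel₀ htw, one_smul]
    exact hβi
  -- boundary readout: `Θ|X_t^σ` is rational
  have hβ : IsRationalClass (complexBetti.map (conjHom σ (fiberι f t)) (2 * p) Θ) :=
    h₄ f o h𝒳 hC hf g hY hcov σ (2 * p) Θ hΘY t ht
  have hc'β : c' = periodTwist σ p • complexBetti.map (conjHom σ (fiberι f t)) (2 * p) Θ := by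
    rw [hc'eq, hΘ, map_smul, smul_smul, mul_inv_cancel₀ htw, one_smul]
  exact ⟨_, hβ, h₃ ht σ p _ c' _ hpp hc' hβ hc'β, hc'β⟩

/-- **The crux, closed modulo exactly the four registered stubs.** -/
theorem BoundaryAbsoluteness_of_stubs : BoundaryAbsoluteness :=
  BoundaryAbsoluteness_of stub_conjugate_exists stub_conjugateNaturality stub_conjugateHodgeType
    stub_boundaryReadout

end Summit.HodgeConjecture.HodgeConjecture.Cruxes.BoundaryAbsoluteness.Birth

end
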